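import Summits.BirchSwinnertonDyer.BirchSwinnertonDyer.Theorems.ClassRecordThreeEulerHalvesAtThreeCoreVertexAdm
import HarnessLib

/-!
# T1 JET (cell `bsd-jet`), road K — STRIKE K5, step 1b: Jetchev 2008 Prop. 6.4 «core vertices exist»,
# FULL printed form, with an ADMISSIBILITY predicate on the primes of the walk (the `_adm` twin of
# `Rank1ResidualJetCoreVertexWalk.lean`, over cell bsd-stepL's `exists_halfCoreVertex_adm`)

HONEST FRAMING (programme file `BSD-LIT2PART-PROGRAMME-v1.md` §HONESTY, verbatim): «no tranche here
proves BSD; ARM L moves the LITERAL column of an r ≤ 1 census into the kernel-proved-modulo-named-print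
column.» THEOREMS of elementary finite-group theory ONLY (seat `bsd-jet-pv-1`, session g8;
`--supports stmt-BirchSwinnertonDyer-14418`, helper); nothing is booked, no flag is struck by this
file, 0 classes move; K1 ∕ K3 ∕ K4 stay `@[conjecture]`.

WHY. The road-K END FORMS of cell `bsd-jet` (`JET.jetchevDivisibilityCarrier{Mult,Ne,Add}_of_localFacts₂`,
`Rank1ResidualJetCarrier*EndFormClosed.lean`) carry, besides published named print, ONE reading binder
that is NOT a published statement: K5 `JET.JetchevCoreVertexExistence` (`Rank1ResidualJetDefs.lean`) =
D. Jetchev, *Global divisibility of Heegner points and Tamagawa numbers*, Compos. Math. **144** (2008),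
Prop. 5.3 (p. 823; = arXiv Prop. 6.4) READ at a prime `p ∣ N`. Cell `bsd-stepL` proved the abstract
HALF-core version `JET.Section6.exists_halfCoreVertex` (p484455, `…EulerHalvesAtThreeCoreVertex.lean`:
the walk `c ↦ cℓ₁ ↦ cℓ₁ℓ₂ ↦ …` reaches a conductor with `𝓗_{𝓕(c')}^{−ε(c')} = 0`) by a potential argument
over the two lozenge inequalities (`…EulerHalvesAtThreeLozenge.lean`). The H63 line of `bsd-jet`
(`JET.tamagawaExponent_le_mInfty_of_localFacts''` and its v3 twin) is keyed to the FULL printed notion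
`Jetchev2008.IsGlobalCoreVertex` (`𝓗^{ε}` cyclic of order `p^m` AND `𝓗^{−ε} = 0`), so to strike K5 from
those END FORMS without re-threading the H63 chain we need Prop. 6.4 in its full printed strength.
This file proves it over the SAME abstract data and hypotheses as cell `bsd-stepL`'s ADMISSIBILITY-indexed
walk `JET.Section6.exists_halfCoreVertex_adm` (`…EulerHalvesAtThreeCoreVertexAdm.lean`): «`ℓ` fresh for
`n`» is generalised to a predicate `Adm n ℓ` implying `ℓ ∉ n` and required of the primes the walk
adjoins (every per-prime hypothesis asked only at admissible `ℓ`, Lemma 6.1 delivering admissible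
ones) — so that the row instantiation can take `Adm n ℓ := «ℓ above every prime factor of c·∏n»` and
feed Prop. 4.7 along increasing prime chains from one-step COMPATIBLE Kolyvagin–Heegner data
(`JET.exists_compatible_data_of_grossCM`, `Koly.h47_of_prop44_of_compatData`). The plain twin
(`Adm n ℓ := ℓ ∉ n`) is `Rank1ResidualJetCoreVertexWalk.lean` (p539971); nothing new is assumed.

## The extra step (why the full form follows from the same inputs)
At a half-core vertex `n` (`𝓗^{−ε} = 0`, `κ̃ ∈ 𝓗^{ε}` of order `p^k`) with `#𝓗^{ε} > p^k`, apply
Lemma 6.1 (`h61`) to the pair (`0` on the `−ε` side, `κ̃ ≠ 0` on the `ε` side) to get a fresh `ℓ` with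
`ord loc_λ κ̃ = p^k`; by `lozenge_epsSide` the `ε(c)`-module at `cℓ` is the strict one, of index `p^k`
in `𝓗^{ε}` (so it is `≠ 0`), and by `lozenge_negSide` with `y = 0` the `−ε(c) = ε(cℓ)`-module at `cℓ` has
`# ≤ p^k · #𝓗^{−ε} = p^k`, while it contains `κ̃_{cℓ}` of order `p^k` — so it IS cyclic of order `p^k`.
The potential `#𝓗^{+}·#𝓗^{−}` is unchanged by this step and drops strictly at the next one
(`halfCoreVertex_step`, p484455), so a strong induction on the potential ends at a conductor with
`#𝓗^{ε} = p^k` and `𝓗^{−ε} = 0`, i.e. a core vertex in the printed sense; `m(c') ≤ m(c)` is carried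
along exactly as in p484455 (Prop. 4.7 + §3.1 items 4–5).

## Dictionary
Identical to `JET.Section6.exists_halfCoreVertex` (module docstring of
`…EulerHalvesAtThreeCoreVertex.lean`): `G ↦ H¹(K, E[p^k])`, `Gs s ↦` its `±`-parts, `loc ℓ ↦ loc_λ`,
`Hf ∕ Htr ↦` finite ∕ transverse conditions at `λ` (disjoint), `Sel n s ↦ 𝓗_{𝓕(cn)}^s`,
`Rel n ℓ s ↦ 𝓗_{𝓕^ℓ(cn)}^s`, `hPT ↦ #loc_λ(𝓗_{𝓕^ℓ(cn)}^s) = p^k` (Thm. 5.1 ∕ Lemma 5.2 (iii)), `e ↦ ε`,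
`h61 ↦` Lemma 6.1, `M ∕ mdiv ∕ mc ↦ M(cn) ∕ m'(cn) ∕ m(cn)`, `κ ∕ κt ↦ κ_{cn,k} ∕ κ̃_{cn,k}`,
`hordκ`, `h47 ↦` Prop. 4.7, `h0 ↦ m(c) < k`.
References (locators only, no cited FACT is declared): [cite: Jetchev2008, §3.1 (p. 817), Prop. 4.7
(p. 820), Thm. 5.1, Lemma 5.2 (pp. 821–822), Lemma 6.1, §6.2 (core vertices), Prop. 6.4 (p. 824)]
[cite: McCallumLMS1991, §3 Cor. 3.2 (p. 299)]. Design: no definitions; `Type*`-polymorphic;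
`Nat.card`; namespace shared with p471669 ∕ p484455. Axioms: `propext`, `Classical.choice`, `Quot.sound`.
-/

set_option autoImplicit false

noncomputable section

open scoped Classical

namespace Summit.BirchSwinnertonDyer.Rank1Residual.JET.Section6

section Walk

variable {G : Type*} [AddCommGroup G] {P : Type*} [DecidableEq P]
  {L : P → Type*} [∀ ℓ, AddCommGroup (L ℓ)]

/-- **The step AT a half-core vertex, admissibility-indexed** (data as in `exists_halfCoreVertex_adm`;
`_adm` twin of `coreVertex_stepAtHalfCore`). Given `n` with
`m(cn) ≤ m(c)` and `𝓗_{𝓕(cn)}^{−ε(cn)} = 0`, there is `ℓ ∉ n` with: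
`m(cnℓ) ≤ m(cn)`, finite Selmer modules at `cnℓ`, `#𝓗_{𝓕(cnℓ)}^{ε(cnℓ)} = p^k`, and
`#𝓗_{𝓕(cnℓ)}^{−ε(cnℓ)} · p^k = #𝓗_{𝓕(cn)}^{ε(cn)}`. PROOF: Lemma 6.1 for the pair (`0`, `κ̃_{cn}`) gives
`ℓ` with `ord loc_λ κ̃_{cn} = p^k`; `lozenge_epsSide` (the `ε(cn)` side loses exactly the image, of order
`p^k`) and `lozenge_negSide` with `y = 0` (the new `ε(cnℓ) = −ε(cn)` side has `# ≤ p^k`, and contains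
`κ̃_{cnℓ}` of order `p^k`). [cite: Jetchev2008, Lemma 5.2, Lemma 6.1, Prop. 6.4 (pp. 821–824)] -/
theorem coreVertex_stepAtHalfCore_adm
    {p k : ℕ} (hp : p.Prime)
    (loc : ∀ ℓ : P, G →+ L ℓ) (Hf Htr : ∀ ℓ : P, Bool → AddSubgroup (L ℓ))
    (hdisj : ∀ ℓ s, Disjoint (Hf ℓ s) (Htr ℓ s))
    (Gs : Bool → AddSubgroup G) (Sel : Finset P → Bool → AddSubgroup G)
    (Rel : Finset P → P → Bool → AddSubgroup G) (hSelGs : ∀ n s, Sel n s ≤ Gs s)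
    (Adm : Finset P → P → Prop) (hAdm : ∀ n ℓ, Adm n ℓ → ℓ ∉ n)
    (hfin : ∀ n ℓ s, Adm n ℓ → Finite (Rel n ℓ s))
    (hSel : ∀ n ℓ s, Adm n ℓ → Sel n s = Rel n ℓ s ⊓ (Hf ℓ s).comap (loc ℓ))
    (hSelT : ∀ n ℓ s, Adm n ℓ → Sel (insert ℓ n) s = Rel n ℓ s ⊓ (Htr ℓ s).comap (loc ℓ))
    (hPT : ∀ n ℓ s, Adm n ℓ → Nat.card ((Rel n ℓ s).map (loc ℓ)) = p ^ k)
    (e : Finset P → Bool) (he : ∀ n ℓ, Adm n ℓ → e (insert ℓ n) = !e n)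
    (h61 : ∀ (s : Bool) (x y : G), x ∈ Gs s → y ∈ Gs (!s) → y ≠ 0 → ∀ n : Finset P,
      ∃ ℓ, Adm n ℓ ∧ addOrderOf (loc ℓ x) = addOrderOf x ∧ addOrderOf (loc ℓ y) = addOrderOf y)
    (M mdiv mc : Finset P → ℕ∞) (hm : ∀ n, mdiv n < M n → mc n ≤ mdiv n)
    (hM : ∀ n, (k : ℕ∞) + mc ∅ ≤ M n)
    (κ κt : Finset P → G)
    (hκt : ∀ n, mc n + k ≤ M n →
      κt n ∈ Sel n (e n) ∧ addOrderOf (κt n) = p ^ k ∧ κ n = p ^ (mc n).toNat • κt n)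
    (hordκ : ∀ n (j : ℕ), j < k → p ^ (k - j) ∣ addOrderOf (κ n) → mdiv n ≤ j)
    (h47 : ∀ n ℓ, Adm n ℓ → addOrderOf (loc ℓ (κ (insert ℓ n))) = addOrderOf (loc ℓ (κ n)))
    (h0 : mc ∅ < k)
    (n : Finset P) (hn : mc n ≤ mc ∅) (hB : Sel n (!e n) = ⊥) :
    ∃ ℓ, ℓ ∉ n ∧ mc (insert ℓ n) ≤ mc n ∧ (∀ s, Finite (Sel (insert ℓ n) s)) ∧
      Nat.card (Sel (insert ℓ n) (e (insert ℓ n))) = p ^ k ∧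
      Nat.card (Sel (insert ℓ n) (!e (insert ℓ n))) * p ^ k = Nat.card (Sel n (e n)) := by
  -- bookkeeping in `ℕ∞`: `mc n` is finite, `< k`, and `mc n + k ≤ M n'` for every `n'`
  have hk0 : 0 < k := by
    have : (mc ∅ : ℕ∞) < k := h0
    exact Nat.pos_of_ne_zero (by rintro rfl; simp at this)
  have hmcn_lt : mc n < (k : ℕ∞) := lt_of_le_of_lt hn h0
  have hmcn_ne : mc n ≠ ⊤ := ne_top_of_lt hmcn_lt
  set t : ℕ := (mc n).toNat with ht
  have hmct : mc n = (t : ℕ∞) := (ENat.coe_toNat hmcn_ne).symm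
  have htk : t < k := by
    have : ((t : ℕ) : ℕ∞) < (k : ℕ∞) := hmct ▸ hmcn_lt
    exact_mod_cast this
  have hMn : ∀ n', mc n + k ≤ M n' := fun n' =>
    calc mc n + (k : ℕ∞) ≤ mc ∅ + k := add_le_add hn le_rfl
      _ = (k : ℕ∞) + mc ∅ := add_comm _ _
      _ ≤ M n' := hM n'
  have hpk1 : 1 < p ^ k := Nat.one_lt_pow hk0.ne' hp.one_lt
  -- the class `κ̃` at `cn`, non-zero
  obtain ⟨hκtSel, hκtord, hκeq⟩ := hκt n (hMn n)
  have hκt0 : κt n ≠ 0 := by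
    intro h
    rw [h, addOrderOf_zero] at hκtord
    omega
  -- Lemma 6.1 for the pair (`0` on the `−ε` side, `κ̃` on the `ε` side): choose `ℓ ∉ n`
  have hκtGs : κt n ∈ Gs (!!e n) := by rw [Bool.not_not]; exact hSelGs _ _ hκtSel
  obtain ⟨ℓ, hA, -, hℓy⟩ := h61 (!e n) 0 (κt n) (AddSubgroup.zero_mem _) hκtGs hκt0 n
  have hℓn : ℓ ∉ n := hAdm n ℓ hA
  rw [hκtord] at hℓy
  haveI : ∀ s, Finite (Rel n ℓ s) := fun s => hfin n ℓ s hA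
  haveI : ∀ s, Finite ((Rel n ℓ s).map (loc ℓ)) := fun s => finite_map_of_finite (loc ℓ) _
  -- ε-side: `Sel n (e n) = Rel`, `Sel n⁺ (e n) = Rel ⊓ ker`, `#Sel n (e n) = #Sel n⁺ (e n) · p^k`
  have hxRel : κt n ∈ Rel n ℓ (e n) := by
    have := hκtSel; rw [hSel n ℓ (e n) hA] at this; exact this.1
  have hxf : loc ℓ (κt n) ∈ Hf ℓ (e n) := by
    have := hκtSel; rw [hSel n ℓ (e n) hA] at this; exact this.2
  obtain ⟨hA1, hA2, hA3⟩ := lozenge_epsSide (loc ℓ) (Rel n ℓ (e n)) (Hf ℓ (e n)) (Htr ℓ (e n))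
    (hdisj ℓ (e n)) hxRel hxf (by rw [hPT n ℓ (e n) hA, hℓy])
  have hSel_e : Sel n (e n) = Rel n ℓ (e n) := by rw [hSel n ℓ (e n) hA, hA1]
  have hSelT_e : Sel (insert ℓ n) (e n) = Rel n ℓ (e n) ⊓ (loc ℓ).ker := by
    rw [hSelT n ℓ (e n) hA, hA2]
  have hcard_e : Nat.card (Sel n (e n)) = Nat.card (Sel (insert ℓ n) (e n)) * p ^ k := by
    rw [hSel_e, hSelT_e, hA3, hℓy]
  -- −ε-side with `y = 0`: `#Sel n⁺ (!e n) ≤ p^k · #Sel n (!e n) = p^k`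
  have hB' := lozenge_negSide (loc ℓ) (Rel n ℓ (!e n)) (Hf ℓ (!e n)) (Htr ℓ (!e n))
    (hdisj ℓ (!e n)) (y := 0) (AddSubgroup.zero_mem _) (by rw [map_zero]; exact AddSubgroup.zero_mem _)
  rw [hPT n ℓ (!e n) hA, map_zero, addOrderOf_zero, one_pow, mul_one, ← hSel n ℓ (!e n) hA,
    ← hSelT n ℓ (!e n) hA, hB, AddSubgroup.card_bot, mul_one] at hB'
  -- finiteness at `n⁺`
  have hfinT : ∀ s, Finite (Sel (insert ℓ n) s) := by
    intro s; rw [hSelT n ℓ s hA]; exact finite_of_le' inf_le_left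
  -- `m(cnℓ) ≤ m(cn)` (Prop. 4.7 + §3.1 bookkeeping), exactly as in `halfCoreVertex_step`
  have hmc : mc (insert ℓ n) ≤ mc n := by
    have hordκn : addOrderOf (loc ℓ (κ n)) = p ^ (k - t) := by
      rw [hκeq, map_nsmul]
      exact addOrderOf_pow_nsmul_eq hp htk.le _ hℓy
    have hdvd : p ^ (k - t) ∣ addOrderOf (κ (insert ℓ n)) := by
      rw [← hordκn, ← h47 n ℓ hA]
      exact addOrderOf_map_dvd (loc ℓ) _
    have h1 : mdiv (insert ℓ n) ≤ (t : ℕ∞) := hordκ _ t htk hdvd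
    have h2 : mdiv (insert ℓ n) < M (insert ℓ n) := by
      calc mdiv (insert ℓ n) ≤ (t : ℕ∞) := h1
        _ = mc n := hmct.symm
        _ < mc n + k := by
            rw [hmct]
            exact_mod_cast Nat.lt_add_of_pos_right hk0
        _ ≤ M (insert ℓ n) := hMn _
    calc mc (insert ℓ n) ≤ mdiv (insert ℓ n) := hm _ h2
      _ ≤ (t : ℕ∞) := h1
      _ = mc n := hmct.symm
  -- the new `ε(cnℓ) = −ε(cn)` side contains `κ̃_{cnℓ}` of order `p^k`, hence has exactly `p^k` elements
  have he' : e (insert ℓ n) = !e n := he n ℓ hA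
  obtain ⟨hκtSel', hκtord', -⟩ := hκt (insert ℓ n) (le_trans (add_le_add hmc le_rfl) (hMn _))
  rw [he'] at hκtSel'
  have hge : p ^ k ≤ Nat.card (Sel (insert ℓ n) (!e n)) := by
    haveI := hfinT (!e n)
    have hdvd : addOrderOf (κt (insert ℓ n)) ∣ Nat.card (Sel (insert ℓ n) (!e n)) :=
      (Sel (insert ℓ n) (!e n)).addOrderOf_dvd_natCard hκtSel'
    rw [hκtord'] at hdvd
    exact Nat.le_of_dvd Nat.card_pos hdvd
  have hcardA : Nat.card (Sel (insert ℓ n) (!e n)) = p ^ k := le_antisymm hB' hge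
  refine ⟨ℓ, hℓn, hmc, hfinT, ?_, ?_⟩
  · rw [he']; exact hcardA
  · rw [he', Bool.not_not, ← hcard_e]

/-- **Jetchev 2008, Prop. 6.4 (p. 824) = printed Prop. 5.3 (p. 823), abstract kernel form — CORE
VERTICES (in the full printed sense) EXIST, admissibility-indexed walk.** Same data and hypotheses as
`JET.Section6.exists_halfCoreVertex_adm` (cell bsd-stepL; `Adm n ℓ` implies `ℓ ∉ n` and is required of
every adjoined prime; see the module docstring); `_adm` twin of `exists_coreVertex` (p539971).
CONCLUSION: some `c' = c·n` has `𝓗_{𝓕(c')}^{−ε(c')} = 0`, `𝓗_{𝓕(c')}^{ε(c')}` CYCLIC OF ORDER `p^k`, and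
`m(c') ≤ m(c)` — the printed «core vertex for `m`» (`Inv 𝓗^{ε} = (m)`, `Inv 𝓗^{−ε} = ()`, §6.2 p. 822)
together with `m(c') ≤ m(c)`; the clause `c' ∈ Λ_{m+m(c)}` is the caller's choice of the pool `P`.
PROOF (NOT the printed invariant-lowering sketch): strong induction on the potential
`Φ = #𝓗^{ε}·#𝓗^{−ε}`; while `𝓗^{−ε} ≠ 0` the step of p484455 lowers `Φ` strictly; at a half-core vertex
with `#𝓗^{ε} > p^k` the step `coreVertex_stepAtHalfCore` keeps `Φ` and makes the `−ε` side non-zero (so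
the next step lowers `Φ`) unless it already lands on a core vertex; at `Φ`'s end `#𝓗^{ε} = p^k`,
`𝓗^{−ε} = 0`, and `𝓗^{ε} ∋ κ̃` of order `p^k` is cyclic.
[cite: Jetchev2008, Prop. 6.4 (p. 824), §6.2 (p. 822); §3.1, Prop. 4.7, Thm. 5.1, Lemma 5.2, Lemma 6.1]
[cite: McCallumLMS1991, Cor. 3.2 (p. 299)] -/
theorem exists_coreVertex_adm
    {p k : ℕ} (hp : p.Prime)
    (loc : ∀ ℓ : P, G →+ L ℓ) (Hf Htr : ∀ ℓ : P, Bool → AddSubgroup (L ℓ))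
    (hdisj : ∀ ℓ s, Disjoint (Hf ℓ s) (Htr ℓ s))
    (Gs : Bool → AddSubgroup G) (Sel : Finset P → Bool → AddSubgroup G)
    (Rel : Finset P → P → Bool → AddSubgroup G) (hSelGs : ∀ n s, Sel n s ≤ Gs s)
    (Adm : Finset P → P → Prop) (hAdm : ∀ n ℓ, Adm n ℓ → ℓ ∉ n)
    (hfin : ∀ n ℓ s, Adm n ℓ → Finite (Rel n ℓ s))
    (hSel : ∀ n ℓ s, Adm n ℓ → Sel n s = Rel n ℓ s ⊓ (Hf ℓ s).comap (loc ℓ))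
    (hSelT : ∀ n ℓ s, Adm n ℓ → Sel (insert ℓ n) s = Rel n ℓ s ⊓ (Htr ℓ s).comap (loc ℓ))
    (hPT : ∀ n ℓ s, Adm n ℓ → Nat.card ((Rel n ℓ s).map (loc ℓ)) = p ^ k)
    (e : Finset P → Bool) (he : ∀ n ℓ, Adm n ℓ → e (insert ℓ n) = !e n)
    (h61 : ∀ (s : Bool) (x y : G), x ∈ Gs s → y ∈ Gs (!s) → y ≠ 0 → ∀ n : Finset P,
      ∃ ℓ, Adm n ℓ ∧ addOrderOf (loc ℓ x) = addOrderOf x ∧ addOrderOf (loc ℓ y) = addOrderOf y)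
    (M mdiv mc : Finset P → ℕ∞) (hm : ∀ n, mdiv n < M n → mc n ≤ mdiv n)
    (hM : ∀ n, (k : ℕ∞) + mc ∅ ≤ M n)
    (κ κt : Finset P → G)
    (hκt : ∀ n, mc n + k ≤ M n →
      κt n ∈ Sel n (e n) ∧ addOrderOf (κt n) = p ^ k ∧ κ n = p ^ (mc n).toNat • κt n)
    (hordκ : ∀ n (j : ℕ), j < k → p ^ (k - j) ∣ addOrderOf (κ n) → mdiv n ≤ j)
    (h47 : ∀ n ℓ, Adm n ℓ → addOrderOf (loc ℓ (κ (insert ℓ n))) = addOrderOf (loc ℓ (κ n)))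
    (h0 : mc ∅ < k) :
    ∃ n : Finset P, Sel n (!e n) = ⊥ ∧ Nat.card (Sel n (e n)) = p ^ k ∧
      IsAddCyclic (Sel n (e n)) ∧ mc n ≤ mc ∅ := by
  have hk0 : 0 < k := by
    have : (mc ∅ : ℕ∞) < k := h0
    exact Nat.pos_of_ne_zero (by rintro rfl; simp at this)
  have hpk1 : 1 < p ^ k := Nat.one_lt_pow hk0.ne' hp.one_lt
  have hMn : ∀ n : Finset P, mc n ≤ mc ∅ → mc n + k ≤ M n := fun n hn =>
    calc mc n + (k : ℕ∞) ≤ mc ∅ + k := add_le_add hn le_rfl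
      _ = (k : ℕ∞) + mc ∅ := add_comm _ _
      _ ≤ M n := hM n
  -- cyclicity at the end: `κ̃_{cn}` of order `p^k` in a group of order `p^k`
  have hcyc : ∀ n : Finset P, mc n ≤ mc ∅ → (∀ s, Finite (Sel n s)) →
      Nat.card (Sel n (e n)) = p ^ k → IsAddCyclic (Sel n (e n)) := by
    intro n hn hfinSel hcard
    haveI := hfinSel (e n)
    obtain ⟨hκtSel, hκtord, -⟩ := hκt n (hMn n hn)
    rw [isAddCyclic_iff_exists_addOrderOf_eq_natCard]
    refine ⟨⟨κt n, hκtSel⟩, ?_⟩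
    rw [← AddSubgroup.addOrderOf_coe, hκtord, hcard]
  -- the inductive claim, on the potential, for conductors with finite Selmer modules
  have claim : ∀ (N : ℕ) (n : Finset P), mc n ≤ mc ∅ → (∀ s, Finite (Sel n s)) →
      Nat.card (Sel n (e n)) * Nat.card (Sel n (!e n)) ≤ N →
      ∃ n' : Finset P, Sel n' (!e n') = ⊥ ∧ Nat.card (Sel n' (e n')) = p ^ k ∧
        (∀ s, Finite (Sel n' s)) ∧ mc n' ≤ mc ∅ := by
    intro N
    induction N using Nat.strong_induction_on with
    | _ N ih =>
      intro n hn hfinSel hΦ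
      by_cases hB : Sel n (!e n) = ⊥
      · by_cases hA : Nat.card (Sel n (e n)) = p ^ k
        · exact ⟨n, hB, hA, hfinSel, hn⟩
        -- a half-core vertex that is not a core vertex: one step that keeps the potential …
        obtain ⟨ℓ, -, hmc, hfinT, hcardA, hcardB⟩ := coreVertex_stepAtHalfCore_adm hp loc Hf Htr hdisj Gs
          Sel Rel hSelGs Adm hAdm hfin hSel hSelT hPT e he h61 M mdiv mc hm hM κ κt hκt hordκ h47 h0 n hn hB
        have hn' : mc (insert ℓ n) ≤ mc ∅ := hmc.trans hn
        by_cases hB' : Sel (insert ℓ n) (!e (insert ℓ n)) = ⊥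
        · exact ⟨insert ℓ n, hB', hcardA, hfinT, hn'⟩
        -- … followed by one step that lowers it
        obtain ⟨ℓ', -, hmc', hfinT', hlt⟩ := halfCoreVertex_step_adm hp loc Hf Htr hdisj Gs Sel Rel hSelGs Adm
          hAdm hfin hSel hSelT hPT e he h61 M mdiv mc hm hM κ κt hκt hordκ h47 h0 (insert ℓ n) hn' hfinT hB'
        have hΦ' : Nat.card (Sel (insert ℓ n) (e (insert ℓ n))) *
            Nat.card (Sel (insert ℓ n) (!e (insert ℓ n))) ≤ N := by
          rw [hcardA, mul_comm, hcardB]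
          calc Nat.card (Sel n (e n)) = Nat.card (Sel n (e n)) * Nat.card (Sel n (!e n)) := by
                rw [hB, AddSubgroup.card_bot, mul_one]
            _ ≤ N := hΦ
        have hltN : Nat.card (Sel (insert ℓ' (insert ℓ n)) (e (insert ℓ' (insert ℓ n)))) *
            Nat.card (Sel (insert ℓ' (insert ℓ n)) (!e (insert ℓ' (insert ℓ n)))) < N :=
          lt_of_lt_of_le hlt hΦ'
        exact ih _ hltN (insert ℓ' (insert ℓ n)) (hmc'.trans hn') hfinT' le_rfl
      · obtain ⟨ℓ, -, hmc, hfinT, hlt⟩ := halfCoreVertex_step_adm hp loc Hf Htr hdisj Gs Sel Rel hSelGs Adm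
          hAdm hfin hSel hSelT hPT e he h61 M mdiv mc hm hM κ κt hκt hordκ h47 h0 n hn hfinSel hB
        exact ih _ (lt_of_lt_of_le hlt hΦ) (insert ℓ n) (hmc.trans hn) hfinT le_rfl
  -- start of the walk: Lemma 6.1 for (`0`, `κ̃_c`) gives some `ℓ`, whence finiteness at `c`
  have hM0 : mc ∅ + k ≤ M ∅ := hMn ∅ le_rfl
  obtain ⟨hκtSel, hκtord, -⟩ := hκt ∅ hM0
  have hκt0 : κt ∅ ≠ 0 := by
    intro h
    rw [h, addOrderOf_zero] at hκtord
    omega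
  have hκtGs : κt ∅ ∈ Gs (!!e ∅) := by rw [Bool.not_not]; exact hSelGs _ _ hκtSel
  obtain ⟨ℓ, hA, -, -⟩ := h61 (!e ∅) 0 (κt ∅) (AddSubgroup.zero_mem _) hκtGs hκt0 ∅
  have hfin0 : ∀ s, Finite (Sel ∅ s) := by
    intro s
    haveI := hfin ∅ ℓ s hA
    rw [hSel ∅ ℓ s hA]
    exact finite_of_le' inf_le_left
  obtain ⟨n, hB, hA, hfinSel, hn⟩ := claim _ ∅ le_rfl hfin0 le_rfl
  exact ⟨n, hB, hA, hcyc n hn hfinSel hA, hn⟩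

end Walk

end Summit.BirchSwinnertonDyer.Rank1Residual.JET.Section6

end
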